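/-
Copyright (c) 2026 the pub-hodgecm-mathlib formalisation cell (harness21).  Prover seat hodgecm-mathlib-A-p17 (g20), floor 0, programme P5
(Alb-CM), in-house road for the letter L4if (ROAD CARD v4 §2, A-p18 (g24)), (A)-prep piece (P2): the letter from the core link (iv).  KERNEL module:
THEOREMS ONLY (no definition, no named fact, no `sorry`, no instance, no notation).
-/
import Summits.HodgeConjecture.HodgeConjecture.Theorems.F0P5LemD14IfFrameInvariance
import Summits.HodgeConjecture.HodgeConjecture.Theorems.F0P5LemD14IfClassMove
import Literature.NumberTheory.Automorphic.Liu2021.LemD1Item4NonsplitLineClassWitness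
import Literature.NumberTheory.Automorphic.Liu2021.LemD1Item4IfFinTwoPairs
import Literature.NumberTheory.Automorphic.Liu2021.LemD1RankTwoCMLetters
import HarnessLib

/-!
# F0 · P5 pay-down line `Cruxes/HLiu418/Lines/F0_P5_CurveThetaLettersPaydown` (ED. 7), letter L4if — THE LETTER FROM THE CORE LINK (iv)

Cell `hodgecm-mathlib`, floor 0, programme P5 (Alb-CM); crux item `stmt-HodgeConjecture-24832`
(`Summit.HodgeConjecture.HodgeConjecture.Theses.HCCMUnconditional.HLiu418`).  The ASSEMBLY of the in-house road for the last local letter of #74,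
★ `Liu2021.LemD1RankTwoCMLetters.LemD1_4IfAsPrintedNonsplitCM₂` (P5 ED. 7 stub `stub_letter_lemD14_if_nonsplit`), MODULO ITS CORE LINK (iv)
(road card `F0/P5/A-p18/g24/ROAD-L4if-v4.A-p18g24.md` §2): **`lemD1_4IfAsPrintedNonsplitCM₂_of_core (hiv) : LemD1_4IfAsPrintedNonsplitCM₂`** where the
hypothesis `hiv` is link (iv) at the enumeration `Equiv.prodUnique (Fin 2) (Fin 1)` in the Θ-currency of ★ (r1) `areIsomorphicRep_localType₂_iff_quot`:
for every datum of the letter (CM field `L`, real non-zero frame `dV : Fin 2 → L`, conjugate-symplectic `λ, λ′` with `Λ′ = Λᶜ·χ̌`, centre character `χ`, line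
`a`, finite place `v` with `c • w = w` for all `w ∣ v`) SOME partner line `b` of the companion class (`b = −t₀t₁·a·u²`, `tᵢ = dVᵢ ∈ L⁺`) with
`Θ_{pU}(Λ′, b; ξ_b) ≅ Θ_{pU}(Λ, a; ξ_a)` as representations of `U(diag dV)(L⁺_v)` — the composite «A-p17 step 3 ∘ (C4bΘ) ∘ §6» of ROAD v4 §2 (iv)
(★ `exists_coinv_equiv_companion_galConj`, (C4bΘ) `F0P5LemD14IfGaloisSimilitudeTheta` (A-p18 (g24)), ★ `apply_finitePart_adelicDet_inclPlace_mul_localCharOfCenter_inv`,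
glued by ★ `F0P5LemD14IfTwistedTransportGlue.areIsomorphicRep_of_twisted_transports`) supplies it at `b := −(a·t₀t₁)⁻¹`, `u := (a·t₀t₁)⁻¹`.

Proof (all links BY NAME): `subst n′ = 2`; ★ B0 `LemD1_4IfAsPrintedI.of_fin_two` (ONE ordered pair suffices; the letter's `μ`- and non-vanishing
clauses are not used — the global `hH : Λ′ = Λᶜ·χ̌` does the work); the class witness `a′⁻¹δ = x xᶜ b⁻¹δ` from the letter's two class hypotheses by ★
(ii-W) `exists_lineDelta_witness_of_lemD1_4_hypotheses` (A-p12 (g18); the family's `eps`, `IsIsotropic` are those of ★ (C5) by `rfl`); ★ (r1) to the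
Θ-currency; then `Θ_{e₁}(Λ′, a′) ≅ Θ_{pU}(Λ′, a′)` (★ (E) `areIsomorphicRep_theta_cmPackage_of_equiv`, A-p12) `≅ Θ_{pU}(Λ′, b)` (★ (CM)
`areIsomorphicRep_theta_cmPackage_classMove`, A-p12) `≅ Θ_{pU}(Λ, a)` (`hiv`) `≅ Θ_{e₁}(Λ, a)` (★ (E)), composed by ★ `AreIsomorphicRep.trans`.

HONEST LABEL: HC_CM is proved only modulo the printed citations — the 2 remaining named inputs (hLiu418, h413) — until rung 0 closes; this
file discharges the letter L4if ONLY RELATIVE TO the hypothesis `hiv` (link (iv)); it closes no stub by itself and touches no book.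

## References
* [Liu2021] Y. Liu, *Fourier–Jacobi cycles and arithmetic relative trace formula*, Camb. J. Math. 9 (2021) = arXiv:2102.11518: App. D §D.1
  Steps 1–3 (l. 5213–5224), Lem. D.1 (3)–(4) (p. 126, l. 5233–5235), proof l. 5240–5262.
* [HarrisKudlaSweet1996] M. Harris, S. Kudla, W. J. Sweet, *Theta dichotomy for unitary groups*, J. AMS 9 (1996), Thm. 6.1.
* [MoeglinVignerasWaldspurger1987] LNM 1291 (1987), Chap. 2 II Remarque (3), Chap. 3 I.1–I.3, IV.
* [GelbartRogawski1991] S. Gelbart, J. Rogawski, Invent. Math. 105 (1991), §3.1 Prop. 3.1.1 p. 455, Remark p. 457 L4–13.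
-/

set_option autoImplicit false
set_option linter.dupNamespace false

noncomputable section

open NumberField IsDedekindDomain Matrix MeasureTheory
open scoped MatrixGroups Kronecker
open Literature.NumberTheory.Automorphic Literature.NumberTheory.Automorphic.UnitaryGroup
open Literature.NumberTheory.GelbartRogawski1991 Literature.NumberTheory.GelbartRogawski1991.UnitaryDualPair
open Literature.NumberTheory.GelbartRogawski1991.UnitaryDualPair.LocalSplitting Literature.NumberTheory.GelbartRogawski1991.UnitaryDualPair.WeilCoinv
open Literature.NumberTheory.GelbartRogawski1991.GRConstruction
open Literature.NumberTheory.Automorphic.IdeleClassGroup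
open Literature.NumberTheory.Automorphic.Liu2021 Literature.NumberTheory.Automorphic.Liu2021.Def411WeilCarriers
open Literature.NumberTheory.Automorphic.Liu2021.Def411WeilCarriersDoubling
open Literature.NumberTheory.Automorphic.Liu2021.LemD1RankTwoCMLetters
open Literature.RepresentationTheory Literature.RepresentationTheory.HeisenbergGroup Literature.RepresentationTheory.Liu2021
open Literature.NumberTheory.GaloisRepresentations Literature.RepresentationTheory.HarrisKudlaSweet1996
open Summit.HodgeConjecture.HodgeConjecture.Cruxes.HLiu418.F0P5LemD14IfFrameInvariance
open Summit.HodgeConjecture.HodgeConjecture.Cruxes.HLiu418.F0P5LemD14IfClassMove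

namespace Summit.HodgeConjecture.HodgeConjecture.Cruxes.HLiu418.F0P5LemD14IfNonsplitLetterOfCore

set_option synthInstance.maxHeartbeats 400000 in
set_option maxHeartbeats 4800000 in
-- measured (1.6 M, 2.4 M] on the check farm (the (r1) unfolding of the letter's two-member family + four Θ-currency links); 2× head-room for the build lane
/-- **THE LETTER L4if FROM THE CORE LINK (iv)** — [Liu2021, Lem. D.1 (4)] «if» direction, second alternative, at the non-split places, for the
two CM θ-package members `(λ, a)`, `(λᶜχ̌, a′)` (★ `LemD1_4IfAsPrintedNonsplitCM₂`), from the hypothesis `hiv` = link (iv) of ROAD v4 §2 at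
`Equiv.prodUnique`: `∃ b u, b = −t₀t₁·a·u² ∧ Θ_{pU}(Λ′, b; ξ_b) ≅ Θ_{pU}(Λ, a; ξ_a)`.  Links (i)–(iii) by name (★ (E), ★ (CM) with the ★ (ii-W) witness),
read through ★ B0 and ★ (r1). [cite: Liu2021, App. D Lemma D.1 (4) (p. 126, l. 5235), proof l. 5249–5255] [cite: HarrisKudlaSweet1996, Thm. 6.1]
[cite: MoeglinVignerasWaldspurger1987, Chap. 3 I.1–I.3, IV] -/
theorem lemD1_4IfAsPrintedNonsplitCM₂_of_core
    (hiv : ∀ (L : Type) [Field L] [NumberField L] [IsCMField L]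
      (dV : Fin 2 → L) (hdV : ∀ i, IsCMField.complexConj L (dV i) = dV i) (hdV0 : ∀ i, dV i ≠ 0)
      (lam : Literature.NumberTheory.Automorphic.IdeleClassGroup L →ₜ* Circle) (hlam : IsConjugateSymplectic L lam)
      (χ : Chi (Fp L) L (IsCMField.complexConj L))
      (lam' : Literature.NumberTheory.Automorphic.IdeleClassGroup L →ₜ* Circle) (hlam' : IsConjugateSymplectic L lam')
      (hcc : IsCMField.complexConj L * IsCMField.complexConj L = 1),
      toHeckeCharacter L lam' =
        toHeckeCharacter L (IdeleClassGroup.galConj (IsCMField.complexConj L) lam) * HeckeCharacter.checkOfChi hcc χ →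
      ∀ (a : (Fp L)ˣ) (v : HeightOneSpectrum (𝓞 (Fp L))),
      (∀ w : UnitaryGroup.PlacesOver L v, IsCMField.complexConj L • (w : HeightOneSpectrum (𝓞 L)) = w) →
      ∃ b u : (Fp L)ˣ, (b : Fp L) = -((⟨dV 0, (IsCMField.complexConj_eq_self_iff (K := L) (dV 0)).1 (hdV 0)⟩ : Fp L) * (⟨dV 1, (IsCMField.complexConj_eq_self_iff (K := L) (dV 1)).1 (hdV 1)⟩ : Fp L)) * a * (u : Fp L) ^ 2 ∧
        AreIsomorphicRep
      (show Representation ℂ (UnitaryGroup.localPi L (IsCMField.complexConj L) 2 (Matrix.diagonal dV) v) _ from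
        (TwistedCoinv.rep (localCharOfCenter (Fp L) L (IsCMField.complexConj L) (JW (Fp L) L b) (JW_apply_ne_zero (Fp L) L b) χ.1 v)
          ((congrW L (Equiv.prodUnique (Fin 2) (Fin 1)) dV hdV (lineW L (TW (Fp L) b)) (complexConj_lineW L (TW (Fp L) b))
            (realDiagonal_lineW L (TW (Fp L) b)) (diagonal_lineW L (TW (Fp L) b) (JW_eq (Fp L) L b))
            (undoubledSplittings L (Equiv.prodUnique (Fin 2) (Fin 1)) dV hdV hdV0 (lineW L (TW (Fp L) b)) (complexConj_lineW L (TW (Fp L) b))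
              (lineW_ne_zero L (TW (Fp L) b) (isUnit_det_TW (Fp L) b)) (toHeckeCharacter L lam') (borelPlaceMeasure L)
              (cmFinLocalFamily L (Equiv.prodUnique (Fin 2) (Fin 1)) dV hdV hdV0 (lineW L (TW (Fp L) b)) (complexConj_lineW L (TW (Fp L) b))
                (lineW_ne_zero L (TW (Fp L) b) (isUnit_det_TW (Fp L) b)) (toHeckeCharacter L lam') ((isOscillatorChar_toHeckeCharacter_iff lam').mpr hlam') (borelPlaceMeasure L)))
            (isSymm_TW (Fp L) b) (JW_eq (Fp L) L b)).omegaLoc v)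
          (commute_omegaLoc_localCenter (Fp L) L (IsCMField.complexConj L) 2 (Equiv.prodUnique (Fin 2) (Fin 1)) (Matrix.diagonal dV) (JW (Fp L) L b)
            (complexConj_imagUnit L) (imagUnit_ne_zero L) (imagUnit_mul_self L) (realDiagonal_isSymm L dV hdV) (isSymm_TW (Fp L) b)
            (realDiagonal_map L dV hdV).symm (JW_eq (Fp L) L b) (JW_apply_ne_zero (Fp L) L b)
            (congrW L (Equiv.prodUnique (Fin 2) (Fin 1)) dV hdV (lineW L (TW (Fp L) b)) (complexConj_lineW L (TW (Fp L) b))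
            (realDiagonal_lineW L (TW (Fp L) b)) (diagonal_lineW L (TW (Fp L) b) (JW_eq (Fp L) L b))
            (undoubledSplittings L (Equiv.prodUnique (Fin 2) (Fin 1)) dV hdV hdV0 (lineW L (TW (Fp L) b)) (complexConj_lineW L (TW (Fp L) b))
              (lineW_ne_zero L (TW (Fp L) b) (isUnit_det_TW (Fp L) b)) (toHeckeCharacter L lam') (borelPlaceMeasure L)
              (cmFinLocalFamily L (Equiv.prodUnique (Fin 2) (Fin 1)) dV hdV hdV0 (lineW L (TW (Fp L) b)) (complexConj_lineW L (TW (Fp L) b))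
                (lineW_ne_zero L (TW (Fp L) b) (isUnit_det_TW (Fp L) b)) (toHeckeCharacter L lam') ((isOscillatorChar_toHeckeCharacter_iff lam').mpr hlam') (borelPlaceMeasure L)))
            (isSymm_TW (Fp L) b) (JW_eq (Fp L) L b)) v)).comp
          (UnitaryGroup.localLineInl L (IsCMField.complexConj L) 2 (Equiv.prodUnique (Fin 2) (Fin 1)) (Matrix.diagonal dV) (JW (Fp L) L b) v))
      (show Representation ℂ (UnitaryGroup.localPi L (IsCMField.complexConj L) 2 (Matrix.diagonal dV) v) _ from
        (TwistedCoinv.rep (localCharOfCenter (Fp L) L (IsCMField.complexConj L) (JW (Fp L) L a) (JW_apply_ne_zero (Fp L) L a) χ.1 v)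
          ((congrW L (Equiv.prodUnique (Fin 2) (Fin 1)) dV hdV (lineW L (TW (Fp L) a)) (complexConj_lineW L (TW (Fp L) a))
            (realDiagonal_lineW L (TW (Fp L) a)) (diagonal_lineW L (TW (Fp L) a) (JW_eq (Fp L) L a))
            (undoubledSplittings L (Equiv.prodUnique (Fin 2) (Fin 1)) dV hdV hdV0 (lineW L (TW (Fp L) a)) (complexConj_lineW L (TW (Fp L) a))
              (lineW_ne_zero L (TW (Fp L) a) (isUnit_det_TW (Fp L) a)) (toHeckeCharacter L lam) (borelPlaceMeasure L)
              (cmFinLocalFamily L (Equiv.prodUnique (Fin 2) (Fin 1)) dV hdV hdV0 (lineW L (TW (Fp L) a)) (complexConj_lineW L (TW (Fp L) a))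
                (lineW_ne_zero L (TW (Fp L) a) (isUnit_det_TW (Fp L) a)) (toHeckeCharacter L lam) ((isOscillatorChar_toHeckeCharacter_iff lam).mpr hlam) (borelPlaceMeasure L)))
            (isSymm_TW (Fp L) a) (JW_eq (Fp L) L a)).omegaLoc v)
          (commute_omegaLoc_localCenter (Fp L) L (IsCMField.complexConj L) 2 (Equiv.prodUnique (Fin 2) (Fin 1)) (Matrix.diagonal dV) (JW (Fp L) L a)
            (complexConj_imagUnit L) (imagUnit_ne_zero L) (imagUnit_mul_self L) (realDiagonal_isSymm L dV hdV) (isSymm_TW (Fp L) a)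
            (realDiagonal_map L dV hdV).symm (JW_eq (Fp L) L a) (JW_apply_ne_zero (Fp L) L a)
            (congrW L (Equiv.prodUnique (Fin 2) (Fin 1)) dV hdV (lineW L (TW (Fp L) a)) (complexConj_lineW L (TW (Fp L) a))
            (realDiagonal_lineW L (TW (Fp L) a)) (diagonal_lineW L (TW (Fp L) a) (JW_eq (Fp L) L a))
            (undoubledSplittings L (Equiv.prodUnique (Fin 2) (Fin 1)) dV hdV hdV0 (lineW L (TW (Fp L) a)) (complexConj_lineW L (TW (Fp L) a))
              (lineW_ne_zero L (TW (Fp L) a) (isUnit_det_TW (Fp L) a)) (toHeckeCharacter L lam) (borelPlaceMeasure L)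
              (cmFinLocalFamily L (Equiv.prodUnique (Fin 2) (Fin 1)) dV hdV hdV0 (lineW L (TW (Fp L) a)) (complexConj_lineW L (TW (Fp L) a))
                (lineW_ne_zero L (TW (Fp L) a) (isUnit_det_TW (Fp L) a)) (toHeckeCharacter L lam) ((isOscillatorChar_toHeckeCharacter_iff lam).mpr hlam) (borelPlaceMeasure L)))
            (isSymm_TW (Fp L) a) (JW_eq (Fp L) L a)) v)).comp
          (UnitaryGroup.localLineInl L (IsCMField.complexConj L) 2 (Equiv.prodUnique (Fin 2) (Fin 1)) (Matrix.diagonal dV) (JW (Fp L) L a) v))) :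
    LemD1_4IfAsPrintedNonsplitCM₂ := by
  intro L _ _ _ dV hdV hdV0 n' e₁ lam hlam a χ a' lam' hlam' hcc hH v hns
  -- `n' = 2` (the letter's enumeration `e₁ : Fin 2 × Fin 1 ≃ Fin n'`)
  obtain rfl : n' = 2 := by
    have h := Fintype.card_congr e₁
    simp only [Fintype.card_prod, Fintype.card_fin, mul_one] at h
    omega
  -- the real frame entries and the frame hypotheses of ★ (ii-W) at `J := diagonal dV`
  have ht : ∀ i, ((⟨dV i, (IsCMField.complexConj_eq_self_iff (K := L) (dV i)).1 (hdV i)⟩ : Fp L)) ≠ 0 := fun i h =>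
    hdV0 i (congrArg Subtype.val h)
  -- the core link (iv) at this data: the partner line `b` and the class arithmetic `b = −D·a·u²`
  obtain ⟨b, u, hb, hcore⟩ := hiv L dV hdV hdV0 lam hlam χ lam' hlam' hcc hH a v hns
  have hbU : b = -(Units.mk0 ((⟨dV 0, (IsCMField.complexConj_eq_self_iff (K := L) (dV 0)).1 (hdV 0)⟩ : Fp L) * (⟨dV 1, (IsCMField.complexConj_eq_self_iff (K := L) (dV 1)).1 (hdV 1)⟩ : Fp L)) (mul_ne_zero (ht 0) (ht 1))) * a * u ^ 2 :=
    Units.ext (by rw [hb, Units.val_mul, Units.val_mul, Units.val_neg, Units.val_mk0, Units.val_pow_eq_pow_val])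
  -- ★ B0: one ordered pair suffices
  refine LemD1_4IfAsPrintedI.of_fin_two fun _ _ _ _ hiso han => ?_
  -- ★ (ii-W): the class witness `a′⁻¹δ = x xᶜ b⁻¹δ` from the letter's two class hypotheses
  obtain ⟨x, hx⟩ := exists_lineDelta_witness_of_lemD1_4_hypotheses (Fp L) L (IsCMField.complexConj L) (complexConj_imagUnit L)
    (imagUnit_ne_zero L) (imagUnit_mul_self L) v (fun i => (⟨dV i, (IsCMField.complexConj_eq_self_iff (K := L) (dV i)).1 (hdV i)⟩ : Fp L)) ht
    (J := Matrix.diagonal dV) (realDiagonal_map L dV hdV).symm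
    (transpose_map_conj_JV (Fp L) L (IsCMField.complexConj L) 2 (Matrix.diagonal dV) (realDiagonal_isSymm L dV hdV) (realDiagonal_map L dV hdV).symm)
    (det_JV_ne_zero (Fp L) L 2 (Matrix.diagonal dV) (isUnit_det_realDiagonal L dV hdV hdV0) (realDiagonal_map L dV hdV).symm)
    a a' b u hbU hiso han
  -- ★ (r1): read the pair `(1, 0)` of the letter's family in the Θ-currency
  refine (areIsomorphicRep_localType₂_iff_quot (Fp L) L (IsCMField.complexConj L) 2 e₁ (Matrix.diagonal dV) (complexConj_imagUnit L)
    (imagUnit_ne_zero L) (imagUnit_mul_self L) (realDiagonal_isSymm L dV hdV) (isUnit_det_realDiagonal L dV hdV hdV0)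
    (realDiagonal_map L dV hdV).symm _ _ _ _ _ _ _ _ v 0 1).2 ?_
  -- links (i) ★ (E), (ii) ★ (CM-b), (iv) `hcore`, (iii)′ ★ (E) back to `e₁`
  have h1 := areIsomorphicRep_theta_cmPackage_of_equiv L v dV hdV hdV0 e₁ (Equiv.prodUnique (Fin 2) (Fin 1)) (toHeckeCharacter L lam') ((isOscillatorChar_toHeckeCharacter_iff lam').mpr hlam') a'
    (localCharOfCenter (Fp L) L (IsCMField.complexConj L) (JW (Fp L) L a') (JW_apply_ne_zero (Fp L) L a') χ.1 v)
  have h2 := areIsomorphicRep_theta_cmPackage_classMove L v dV hdV hdV0 (toHeckeCharacter L lam') ((isOscillatorChar_toHeckeCharacter_iff lam').mpr hlam') le_rfl χ b a' x hx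
  have h4 := areIsomorphicRep_theta_cmPackage_of_equiv L v dV hdV hdV0 (Equiv.prodUnique (Fin 2) (Fin 1)) e₁ (toHeckeCharacter L lam) ((isOscillatorChar_toHeckeCharacter_iff lam).mpr hlam) a
    (localCharOfCenter (Fp L) L (IsCMField.complexConj L) (JW (Fp L) L a) (JW_apply_ne_zero (Fp L) L a) χ.1 v)
  exact h1.trans (h2.trans (hcore.trans h4))

end Summit.HodgeConjecture.HodgeConjecture.Cruxes.HLiu418.F0P5LemD14IfNonsplitLetterOfCore

end
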